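import Mathlib
import Summits.KontsevichZagierPeriods.KontsevichZagierPeriods.Theorems.InverseLandauTateLiftingPullback
import Literature.NumberTheory.Transcendental.GenusZeroPeriodsMZVProofs
import Literature.NumberTheory.Transcendental.MZVSimplexRep

/-!
# `TateLifting` (stmt-KontsevichZagierPeriods-9129), line `Sketch` — stub `stub_simplexChart`

THE CUBICAL CHART OF THE ORDERED SIMPLEX (stub 51, the body of `SimplexChart`). The cubical
coordinates `Φ(x)_i = x₀x₁⋯x_i` (Brown's `t_i = x_0 ⋯ x_i`, `Hyperlog.φc`) carry the open cube
`(0,1)ⁿ` bijectively onto the open ordered simplex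
`KZ.openOrderedSimplex n = {1 > t₀ > t₁ > ⋯ > t_{n-1} > 0}` (`Hyperlog.φc_injOn`, `Hyperlog.φc_image`),
with derivative `Hyperlog.φc'` of POSITIVE Jacobian determinant `∏_i ∏_{k<i} x_k` on the cube
(`Hyperlog.det_φc'`, `Hyperlog.det_φc'_pos`). Hence:

* (i) for every representation `r = [Δ, f]` over the ordered simplex, the honest pulled-back
  representation `r' = [(0,1)ⁿ, (∏_i ∏_{k<i} x_k) · f(Φ x)]` exists and
  `[Δ, f] − r' ∈ KZ.relations` — ONE change of variables (Kontsevich–Zagier's rule (2)) with a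
  constructed source, packaged by `tateLifting_pullback`; the cube is `ℚ`-semialgebraic and `Φ`,
  the Jacobian are polynomial (hence `ℚ`-semialgebraic) maps;
* (ii) polynomial bookkeeping: for `P ∈ K[t₀, …, t_{n-1}]`, `K = ℚ̄ ∩ ℝ`, the function
  `x ↦ (∏_i ∏_{k<i} x_k) · P(Φ x)` is again a polynomial over `K`, namely
  `(∏_i ∏_{k<i} X_k) · P(X₀, X₀X₁, …)` (`MvPolynomial.bind₁`).

References: M. Kontsevich, D. Zagier, *Periods* (2001), §1.2 rule (2); F. Brown, *Multiple zeta
values and periods of moduli spaces 𝔐̄_{0,n}*, Ann. Sci. ÉNS 42 (2009), §2.2 (cubical coordinates).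
-/

noncomputable section

open MeasureTheory Set
open Literature.NumberTheory.Transcendental
open Literature.ModelTheory.ExponentialFields (IsSemialgebraic isSemialgebraic_setOf_eval_pos)
open MvPolynomial (aeval X)

namespace Summit.KontsevichZagierPeriods.InverseLandau

namespace SimplexChart

variable {n : ℕ}

/-- The open unit cube `(0,1)ⁿ = {x | ∀ i, 0 < x i < 1}` is `ℚ`-semialgebraic: the finite
intersection of the strict polynomial inequalities `0 < X_i`, `0 < 1 - X_i`. [folklore] -/
theorem isSemialgebraic_cube : IsSemialgebraic ℚ (Hyperlog.cube n) := by
  have h : Hyperlog.cube n = ⋂ j ∈ (Finset.univ : Finset (Fin n)),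
      ({x | 0 < aeval x (X j : MvPolynomial (Fin n) ℚ)} ∩
        {x | 0 < aeval x (1 - X j : MvPolynomial (Fin n) ℚ)}) := by
    ext x
    simp [Hyperlog.cube, sub_pos]
  rw [h]
  exact IsSemialgebraic.biInter _ _ fun j _ =>
    (isSemialgebraic_setOf_eval_pos _).inter (isSemialgebraic_setOf_eval_pos _)

/-- The cubical coordinates `x ↦ (∏_{j ≤ i} x_j)_i` form a `ℚ`-semialgebraic map on the open cube
(a polynomial map). [cite: BrownENS2009, §2.2] -/
theorem isSemialgebraicMapOn_chart :
    IsSemialgebraicMapOn ℚ (Hyperlog.cube n)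
      (fun x : Fin n → ℝ => fun i : Fin n => ∏ j ∈ Finset.Iic i, x j) :=
  (isSemialgebraicMapOn_aeval isSemialgebraic_cube
    fun i : Fin n => (∏ j ∈ Finset.Iic i, X j : MvPolynomial (Fin n) ℚ)).congr fun x _ => by
      funext i
      simp [map_prod]

/-- The Jacobian `x ↦ ∏_i ∏_{k<i} x_k` of the cubical coordinates is a `ℚ`-semialgebraic function
on the open cube (a polynomial). [folklore] -/
theorem isSemialgebraicFunOn_jacobian :
    IsSemialgebraicFunOn ℚ (Hyperlog.cube n)
      (fun x : Fin n → ℝ => ∏ i : Fin n, ∏ k ∈ Finset.Iio i, x k) :=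
  (isSemialgebraicFunOn_aeval isSemialgebraic_cube
    (∏ i : Fin n, ∏ k ∈ Finset.Iio i, X k : MvPolynomial (Fin n) ℚ)).congr fun x _ => by
      simp [map_prod]

/-- On the open cube the Jacobian `∏_i ∏_{k<i} x_k` is `|det φc'(x)|` (the determinant is positive
there). [cite: BrownENS2009, §2.2] -/
theorem jacobian_eq_abs_det (x : Fin n → ℝ) (hx : x ∈ Hyperlog.cube n) :
    (∏ i : Fin n, ∏ k ∈ Finset.Iio i, x k) = |(Hyperlog.φc' x).det| := by
  rw [abs_of_pos (Hyperlog.det_φc'_pos hx), Hyperlog.det_φc']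

/-- **The move** (conjunct (i) over the cube in the form `Hyperlog.cube n`): the honest pull-back of
`r = [Δ, f]` along the cubical chart exists and differs from `r` by relations.
[cite: KontsevichZagier2001, §1.2 rule (2)] -/
theorem pullback_cube (r : KZ.IntegralRep n) (hr : r.domain = KZ.openOrderedSimplex n) :
    ∃ r' : KZ.IntegralRep n, r'.domain = Hyperlog.cube n ∧
      (r'.integrand = fun x => (∏ i : Fin n, ∏ k ∈ Finset.Iio i, x k) *
        r.integrand (fun i => ∏ j ∈ Finset.Iic i, x j)) ∧
      KZ.of r - KZ.of r' ∈ KZ.relations :=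
  tateLifting_pullback n r (Hyperlog.cube n)
    (fun x : Fin n → ℝ => fun i : Fin n => ∏ j ∈ Finset.Iic i, x j) Hyperlog.φc'
    (fun x : Fin n → ℝ => ∏ i : Fin n, ∏ k ∈ Finset.Iio i, x k) isSemialgebraic_cube
    isSemialgebraicMapOn_chart (fun x _ => (Hyperlog.hasFDerivAt_φc x).hasFDerivWithinAt)
    Hyperlog.φc_injOn (Hyperlog.φc_image.trans hr.symm) isSemialgebraicFunOn_jacobian
    jacobian_eq_abs_det

/-- **Polynomial bookkeeping** (conjunct (ii)): `(∏_i ∏_{k<i} x_k) · P(Φ x)` is the value at `x`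
of the polynomial `(∏_i ∏_{k<i} X_k) · P(X₀, X₀X₁, …, X₀⋯X_{n-1})` over `K = ℚ̄ ∩ ℝ`. [folklore] -/
theorem poly_chart (P : MvPolynomial (Fin n) (algebraicClosure ℚ ℝ)) :
    ∃ P' : MvPolynomial (Fin n) (algebraicClosure ℚ ℝ),
      ∀ x : Fin n → ℝ, (MvPolynomial.aeval x P' : ℝ) =
        (∏ i : Fin n, ∏ k ∈ Finset.Iio i, x k) *
          MvPolynomial.aeval (fun i => ∏ j ∈ Finset.Iic i, x j) P := by
  refine ⟨(∏ i : Fin n, ∏ k ∈ Finset.Iio i, X k) *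
    MvPolynomial.bind₁ (fun i => ∏ j ∈ Finset.Iic i, X j) P, fun x => ?_⟩
  simp only [map_mul, map_prod, MvPolynomial.aeval_bind₁, MvPolynomial.aeval_X]

end SimplexChart

/-- **The cubical chart of the ordered simplex** (stub `stub_simplexChart` of the lead's skeleton,
the body of `SimplexChart`), every dimension `n`: (i) a representation `r = [Δ, f]` over the open
ordered simplex `Δ = {1 > t₀ > ⋯ > t_{n−1} > 0}` differs by relations from the honest pull-back
`[(0,1)ⁿ, (∏_i ∏_{k<i} x_k) · f(x₀, x₀x₁, …, x₀⋯x_{n−1})]` over the open cube — ONE change of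
variables along the cubical coordinates `t_i = x₀⋯x_i` (Kontsevich–Zagier's rule (2),
`tateLifting_pullback` with `Φ = Hyperlog.φc`, Jacobian `det φc' = ∏_i ∏_{k<i} x_k > 0`);
(ii) for a polynomial `P` over `K = ℚ̄ ∩ ℝ`, `(∏_i ∏_{k<i} x_k) · P(Φ x)` is again a polynomial
over `K`. [cite: KontsevichZagier2001, §1.2 rule (2)] -/
theorem tateLifting_simplexChart :
  ∀ n : ℕ,
    (∀ r : KZ.IntegralRep n, r.domain = KZ.openOrderedSimplex n →
      ∃ r' : KZ.IntegralRep n, r'.domain = Set.pi Set.univ (fun _ => Set.Ioo (0 : ℝ) 1) ∧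
        (r'.integrand = fun x => (∏ i : Fin n, ∏ k ∈ Finset.Iio i, x k) *
          r.integrand (fun i => ∏ j ∈ Finset.Iic i, x j)) ∧
        KZ.of r - KZ.of r' ∈ KZ.relations) ∧
    (∀ P : MvPolynomial (Fin n) (algebraicClosure ℚ ℝ),
      ∃ P' : MvPolynomial (Fin n) (algebraicClosure ℚ ℝ),
        ∀ x : Fin n → ℝ, (MvPolynomial.aeval x P' : ℝ) =
          (∏ i : Fin n, ∏ k ∈ Finset.Iio i, x k) * MvPolynomial.aeval (fun i => ∏ j ∈ Finset.Iic i, x j) P) := by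
  intro n
  refine ⟨fun r hr => ?_, SimplexChart.poly_chart⟩
  have h := SimplexChart.pullback_cube r hr
  rw [Hyperlog.cube_eq_pi] at h
  exact h

end Summit.KontsevichZagierPeriods.InverseLandau

end
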